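import Mathlib
import HarnessLib
import Summits.Ventures.LatticeQCDFlow.Exactness.SUNEngineMomentumMoments

/-!
# Equipartition for the engine's momentum refresh: `⟨q(p_l)⟩ = D/2` exactly, `⟨−Σ tr P_l²⟩ = |L|·D/2`

HONEST FRAMING: exact (Metropolis-corrected) sampling algorithms for lattice gauge theory;
figures of merit are autocorrelation/cost numbers at stated couplings and volumes; no
continuum-physics claim.

Venture `LatticeQCDFlow` (cell pub-lqcd), topic `Exactness`, FANOUT row 14 (eng-flowhmc, the
learned-map-inside-HMC engine `latflow.fthmc`; its `SU(N)` momentum heat-bath is row 9's: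
`P = i(H − tr H/N)`, density `∝ e^{tr P²} = e^{−q}` in the engine's coordinates `SUNCoords N`, kinetic
term `sunKinetic N p = Σ_l q(p_l)`).  NEW WORK of the cell over the tree (`SUNEngineMomentumMoments`:
one-link expectations reduce to one-factor Gaussian integrals, `E‖p_l‖² ≤ (√2)^D`;
`SUNLeapfrogHMCEngine`: `‖c‖² ≤ q(c)`, `∫ e^{−q} < ∞`); nothing here is cited as a fact.
WHAT THIS FILE ADDS — the textbook equipartition check of an HMC momentum heat-bath, as an identity:
* §1 (any finite-dimensional real normed space `E` with its Borel σ-algebra, any additive Haar measure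
  `μ`, any CONTINUOUS function `q` that is homogeneous of degree two, `q(s•x) = s²q(x)`, and coercive,
  `m‖x‖² ≤ q(x)` with `m > 0`): the Gaussian scaling law **`∫ e^{−t q} dμ = t^{−D/2} ∫ e^{−q} dμ`**
  (`t > 0`, `D = finrank ℝ E`; `integral_exp_neg_mul_quadHom`), differentiation under the integral sign
  at `t = 1` (`hasDerivAt_integral_exp_neg_mul_quadHom`), and hence THE EQUIPARTITION IDENTITY
  **`∫ q e^{−q} dμ = (D/2) ∫ e^{−q} dμ`** (`integral_quadHom_mul_exp_neg`).
* §2 (the engine): `q = sunCoordQuad N` on `SUNCoords N` is such a function (`m = 1`), so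
  **`E q(p_l) = D/2`** for every link under the refresh law `Z⁻¹e^{−sunKinetic}dμ^{⊗L}`
  (`integral_sunCoordQuad_apply_sunKineticLaw`), **`E sunKinetic N p = |L|·D/2`**
  (`integral_sunKinetic_sunKineticLaw` — the `⟨K⟩ = #dof/2` check of the heat-bath), and the moment
  bounds of `SUNEngineMomentumMoments` sharpen from `(√2)^D` to **`E‖p_l‖² ≤ D/2`**,
  **`E‖p_l‖ ≤ √(D/2)`**, `E Σ_l‖p_l‖ ≤ |L|√(D/2)`, `E(Σ_l‖p_l‖)² ≤ |L|²·D/2`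
  (`integral_norm_apply_sq_sunKineticLaw_le_half_finrank`, …) — the constants that enter the engine's
  SU(N) mean-acceptance law (`SUNEngineWilsonMeanAcceptance`) become polynomial in `D = N² − 1`.

* §3: the number of degrees of freedom **`D + 1 = N²`** (`finrank_sunCoords_add_one`: rank–nullity
  for the zero-sum diagonal, `2·#{i<j} + N = N²` by the swap symmetry of the off-diagonal pairs), so for
  `N ≥ 1`: **`E q(p_l) = (N² − 1)/2`** and **`E(−Σ_l tr P_l²) = |L|·(N² − 1)/2`**.
NOT CLAIMED: higher moments or the full (χ²) law of the kinetic energy; anything numerical.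
-/

noncomputable section
namespace Summit.Ventures.LatticeQCDFlow.Exactness

open Set MeasureTheory Filter Topology
open scoped ENNReal

/-! ## §1 Equipartition for a coercive degree-two homogeneous weight on a finite-dimensional space -/

section General
variable {E : Type*} [NormedAddCommGroup E] [NormedSpace ℝ E] [FiniteDimensional ℝ E]
  [MeasurableSpace E] [BorelSpace E] (μ : Measure E) [μ.IsAddHaarMeasure]
  {q : E → ℝ} {m : ℝ}

omit [NormedSpace ℝ E] [FiniteDimensional ℝ E] [MeasurableSpace E] [BorelSpace E] in
/-- A coercive weight is nonnegative. -/
theorem quadHom_nonneg (hm : 0 < m) (hcoer : ∀ x, m * ‖x‖ ^ 2 ≤ q x) (x : E) : 0 ≤ q x :=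
  le_trans (by positivity) (hcoer x)

omit [NormedSpace ℝ E] [FiniteDimensional ℝ E] [MeasurableSpace E] [BorelSpace E] in
/-- `u·e^{−u/4} ≤ 4` in the form `q e^{−q/4} ≤ 4` (`1 + y ≤ e^y`). -/
theorem quadHom_mul_exp_neg_quarter_le (hm : 0 < m) (hcoer : ∀ x, m * ‖x‖ ^ 2 ≤ q x) (x : E) :
    q x * Real.exp (-(1 / 4 * q x)) ≤ 4 := by
  have hq := quadHom_nonneg hm hcoer x
  have h1 : q x / 4 ≤ Real.exp (q x / 4) := by linarith [Real.add_one_le_exp (q x / 4)]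
  have h2 : Real.exp (-(1 / 4 * q x)) = (Real.exp (q x / 4))⁻¹ := by
    rw [← Real.exp_neg]; congr 1; ring
  rw [h2, mul_inv_le_iff₀ (Real.exp_pos _)]
  linarith

/-- `e^{−t q}` is integrable for `t > 0` (comparison with `e^{−‖y‖²}` after the substitution
`y = √(tm)•x`). -/
theorem integrable_exp_neg_mul_quadHom (hq : Continuous q) (hm : 0 < m)
    (hcoer : ∀ x, m * ‖x‖ ^ 2 ≤ q x) {t : ℝ} (ht : 0 < t) :
    Integrable (fun x => Real.exp (-(t * q x))) μ := by
  have hmeas : AEStronglyMeasurable (fun x => Real.exp (-(t * q x))) μ :=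
    (continuous_const.mul hq).neg.rexp.aestronglyMeasurable
  -- domination by `e^{−(tm)‖x‖²} = e^{−‖√(tm)•x‖²}`, integrable by Haar scaling of `e^{−‖y‖²}`
  have htm : 0 < t * m := mul_pos ht hm
  have hgi : Integrable (fun x : E => Real.exp (-‖x‖ ^ 2)) μ := by
    refine ⟨continuous_norm.pow 2 |>.neg.rexp.aestronglyMeasurable,
      (hasFiniteIntegral_iff_ofReal (Eventually.of_forall fun x => (Real.exp_pos _).le)).2 ?_⟩
    exact lintegral_exp_neg_norm_sq_lt_top μ
  have hsi : Integrable (fun x : E => Real.exp (-‖Real.sqrt (t * m) • x‖ ^ 2)) μ :=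
    (integrable_comp_smul_iff μ (fun y : E => Real.exp (-‖y‖ ^ 2)) (Real.sqrt_pos.2 htm).ne').2 hgi
  refine Integrable.mono' hsi hmeas (Eventually.of_forall fun x => ?_)
  rw [Real.norm_eq_abs, abs_of_pos (Real.exp_pos _), norm_smul, Real.norm_eq_abs,
    abs_of_nonneg (Real.sqrt_nonneg _), mul_pow, Real.sq_sqrt htm.le]
  exact Real.exp_le_exp.2 (by nlinarith [hcoer x])

/-- **Gaussian scaling law**: `∫ e^{−t q} dμ = t^{−D/2} · ∫ e^{−q} dμ` for `t > 0`. -/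
theorem integral_exp_neg_mul_quadHom (hhom : ∀ (s : ℝ) (x : E), q (s • x) = s ^ 2 * q x)
    {t : ℝ} (ht : 0 < t) :
    ∫ x, Real.exp (-(t * q x)) ∂μ =
      t ^ (-(Module.finrank ℝ E : ℝ) / 2) * ∫ x, Real.exp (-q x) ∂μ := by
  have hs : ∀ x : E, Real.exp (-(t * q x)) = Real.exp (-q (Real.sqrt t • x)) := fun x => by
    rw [hhom, Real.sq_sqrt ht.le]
  simp_rw [hs]
  rw [Measure.integral_comp_smul μ (fun x => Real.exp (-q x)) (Real.sqrt t), smul_eq_mul]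
  congr 1
  rw [abs_of_nonneg (by positivity), ← Real.rpow_natCast, ← Real.rpow_neg (Real.sqrt_nonneg _),
    Real.sqrt_eq_rpow, ← Real.rpow_mul ht.le]
  congr 1
  ring

/-- **Differentiation under the integral sign** at `t = 1`:
`d/dt ∫ e^{−t q} dμ |_{t=1} = −∫ q e^{−q} dμ`, and `q e^{−q}` is integrable. -/
theorem hasDerivAt_integral_exp_neg_mul_quadHom (hq : Continuous q) (hm : 0 < m)
    (hcoer : ∀ x, m * ‖x‖ ^ 2 ≤ q x) :
    Integrable (fun x => -q x * Real.exp (-(1 * q x))) μ ∧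
      HasDerivAt (fun t : ℝ => ∫ x, Real.exp (-(t * q x)) ∂μ) (∫ x, -q x * Real.exp (-(1 * q x)) ∂μ) 1 := by
  have hq0 := quadHom_nonneg hm hcoer
  have hs : Set.Ioi (1 / 2 : ℝ) ∈ 𝓝 (1 : ℝ) := Ioi_mem_nhds (by norm_num)
  refine hasDerivAt_integral_of_dominated_loc_of_deriv_le (F := fun t x => Real.exp (-(t * q x)))
    (F' := fun t x => -q x * Real.exp (-(t * q x))) (bound := fun x => 4 * Real.exp (-(1 / 4 * q x)))
    (x₀ := (1 : ℝ)) hs ?_ ?_ ?_ ?_ ?_ ?_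
  · exact Eventually.of_forall fun t => (continuous_const.mul hq).neg.rexp.aestronglyMeasurable
  · exact integrable_exp_neg_mul_quadHom μ hq hm hcoer one_pos
  · exact (hq.neg.mul (continuous_const.mul hq).neg.rexp).aestronglyMeasurable
  · refine Eventually.of_forall fun x t ht => ?_
    have ht' : 1 / 2 < t := ht
    rw [norm_mul, norm_neg, Real.norm_eq_abs, abs_of_nonneg (hq0 x), Real.norm_eq_abs,
      abs_of_pos (Real.exp_pos _)]
    -- `q e^{−tq} ≤ q e^{−q/2} = (q e^{−q/4}) e^{−q/4} ≤ 4 e^{−q/4}`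
    have hexp : Real.exp (-(t * q x)) ≤ Real.exp (-(1 / 4 * q x)) * Real.exp (-(1 / 4 * q x)) := by
      rw [← Real.exp_add]
      exact Real.exp_le_exp.2 (by nlinarith [hq0 x])
    calc q x * Real.exp (-(t * q x))
        ≤ q x * (Real.exp (-(1 / 4 * q x)) * Real.exp (-(1 / 4 * q x))) :=
          mul_le_mul_of_nonneg_left hexp (hq0 x)
      _ = (q x * Real.exp (-(1 / 4 * q x))) * Real.exp (-(1 / 4 * q x)) := by ring
      _ ≤ 4 * Real.exp (-(1 / 4 * q x)) :=
          mul_le_mul_of_nonneg_right (quadHom_mul_exp_neg_quarter_le hm hcoer x) (Real.exp_pos _).le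
  · exact (integrable_exp_neg_mul_quadHom μ hq hm hcoer (by norm_num : (0 : ℝ) < 1 / 4)).const_mul 4
  · refine Eventually.of_forall fun x t _ => ?_
    have h := ((hasDerivAt_id t).mul_const (q x)).neg.exp
    simpa [mul_comm] using h

/-- **THE EQUIPARTITION IDENTITY** for a coercive, continuous, degree-two homogeneous weight on a
`D`-dimensional real normed space with an additive Haar measure: `∫ q e^{−q} dμ = (D/2) ∫ e^{−q} dμ`
(the scaling law differentiated at `t = 1`, uniqueness of the derivative). -/
theorem integral_quadHom_mul_exp_neg (hq : Continuous q) (hm : 0 < m)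
    (hcoer : ∀ x, m * ‖x‖ ^ 2 ≤ q x) (hhom : ∀ (s : ℝ) (x : E), q (s • x) = s ^ 2 * q x) :
    ∫ x, q x * Real.exp (-q x) ∂μ = (Module.finrank ℝ E : ℝ) / 2 * ∫ x, Real.exp (-q x) ∂μ := by
  set Z : ℝ := ∫ x, Real.exp (-q x) ∂μ with hZ
  set D : ℕ := Module.finrank ℝ E with hD
  -- derivative of `t ↦ ∫ e^{−tq}` at 1, computed under the integral sign
  have h1 := (hasDerivAt_integral_exp_neg_mul_quadHom μ hq hm hcoer).2
  -- the same function equals `t ↦ t^{−D/2}·Z` near `t = 1`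
  have heq : (fun t : ℝ => ∫ x, Real.exp (-(t * q x)) ∂μ) =ᶠ[𝓝 1]
      fun t : ℝ => t ^ (-(D : ℝ) / 2) * Z := by
    filter_upwards [Ioi_mem_nhds (zero_lt_one' ℝ)] with t ht
    exact integral_exp_neg_mul_quadHom μ hhom ht
  have h2 : HasDerivAt (fun t : ℝ => t ^ (-(D : ℝ) / 2) * Z) ((-(D : ℝ) / 2) * (1 : ℝ) ^ (-(D : ℝ) / 2 - 1) * Z) 1 :=
    ((Real.hasDerivAt_rpow_const (Or.inl one_ne_zero))).mul_const Z
  rw [Real.one_rpow] at h2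
  have h3 : HasDerivAt (fun t : ℝ => ∫ x, Real.exp (-(t * q x)) ∂μ) ((-(D : ℝ) / 2) * 1 * Z) 1 :=
    h2.congr_of_eventuallyEq heq
  have huniq := h1.unique h3
  have hlhs : ∫ x, -q x * Real.exp (-(1 * q x)) ∂μ = -∫ x, q x * Real.exp (-q x) ∂μ := by
    rw [← integral_neg]
    refine integral_congr_ae (Eventually.of_forall fun x => ?_)
    simp only [one_mul, neg_mul]
  rw [hlhs] at huniq
  linarith
end General

/-! ## §2 The engine's refresh: `E q(p_l) = D/2`, `E T = |L|·D/2`, and sharper norm moments -/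

section Engine
variable (N : ℕ) (μ : Measure (SUNCoords N)) [μ.IsAddHaarMeasure]

/-- **Equipartition for the engine's one-link Gaussian**: `∫ q e^{−q} dμ = (D/2)·∫ e^{−q} dμ` with
`q = sunCoordQuad N` (`= −tr P²`) and `D = finrank ℝ (SUNCoords N)`. -/
theorem integral_sunCoordQuad_mul_exp_neg :
    ∫ c, sunCoordQuad N c * Real.exp (-sunCoordQuad N c) ∂μ =
      (Module.finrank ℝ (SUNCoords N) : ℝ) / 2 * ∫ c, Real.exp (-sunCoordQuad N c) ∂μ :=
  integral_quadHom_mul_exp_neg μ (continuous_sunCoordQuad N) one_pos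
    (fun c => by simpa only [one_mul] using norm_sq_le_sunCoordQuad N c) (sunCoordQuad_smul N)

/-- `q e^{−q}` is integrable (one link). -/
theorem integrable_sunCoordQuad_mul_exp_neg :
    Integrable (fun c => sunCoordQuad N c * Real.exp (-sunCoordQuad N c)) μ := by
  have h := (hasDerivAt_integral_exp_neg_mul_quadHom μ (continuous_sunCoordQuad N) one_pos
    (fun c => by simpa only [one_mul] using norm_sq_le_sunCoordQuad N c)).1
  refine h.neg.congr (Eventually.of_forall fun c => ?_)
  simp only [Pi.neg_apply, one_mul, neg_mul, neg_neg]

variable {L : Type*} [Fintype L]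

/-- **`E q(p_l) = D/2`** for every link `l` under the engine's refresh law
`Z⁻¹ e^{−sunKinetic N} dμ^{⊗L}` — equipartition per link. -/
theorem integral_sunCoordQuad_apply_sunKineticLaw (l : L) :
    ∫ p, sunCoordQuad N (p l) ∂(sunMomentumLaw (L := L) μ (sunKinetic N)) =
      (Module.finrank ℝ (SUNCoords N) : ℝ) / 2 := by
  rw [integral_apply_sunMomentumLaw_sunKinetic N μ (φ := sunCoordQuad N) (sunCoordQuad_nonneg N)
    (continuous_sunCoordQuad N).measurable (integrable_sunCoordQuad_mul_exp_neg N μ) l,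
    integral_sunCoordQuad_mul_exp_neg, mul_div_assoc,
    div_self (integral_exp_neg_sunCoordQuad_pos N μ).ne', mul_one]

/-- `q(p_l)` is integrable under the refresh law. -/
theorem integrable_sunCoordQuad_apply_sunKineticLaw (l : L) :
    Integrable (fun p : L → SUNCoords N => sunCoordQuad N (p l)) (sunMomentumLaw (L := L) μ (sunKinetic N)) :=
  integrable_apply_sunMomentumLaw_sunKinetic N μ (φ := sunCoordQuad N) (sunCoordQuad_nonneg N)
    (continuous_sunCoordQuad N).measurable (integrable_sunCoordQuad_mul_exp_neg N μ) l

/-- **`E sunKinetic N p = |L|·D/2`** — the `⟨K⟩ = #dof/2` check of the momentum heat-bath, exactly. -/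
theorem integral_sunKinetic_sunKineticLaw :
    ∫ p, sunKinetic N p ∂(sunMomentumLaw (L := L) μ (sunKinetic N)) =
      Fintype.card L * ((Module.finrank ℝ (SUNCoords N) : ℝ) / 2) := by
  calc ∫ p, sunKinetic N p ∂(sunMomentumLaw (L := L) μ (sunKinetic N))
      = ∫ p, ∑ l, sunCoordQuad N (p l) ∂(sunMomentumLaw (L := L) μ (sunKinetic N)) :=
        integral_congr_ae (Eventually.of_forall fun p => rfl)
    _ = ∑ l, ∫ p, sunCoordQuad N (p l) ∂(sunMomentumLaw (L := L) μ (sunKinetic N)) :=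
        integral_finsetSum _ fun l _ => integrable_sunCoordQuad_apply_sunKineticLaw N μ l
    _ = ∑ _l : L, (Module.finrank ℝ (SUNCoords N) : ℝ) / 2 :=
        Finset.sum_congr rfl fun l _ => integral_sunCoordQuad_apply_sunKineticLaw N μ l
    _ = Fintype.card L * ((Module.finrank ℝ (SUNCoords N) : ℝ) / 2) := by
        rw [Finset.sum_const, Finset.card_univ, nsmul_eq_mul]

/-- **`E‖p_l‖² ≤ D/2`** (sup norm of the coordinate space; `‖c‖² ≤ q(c)`), sharpening
`integral_norm_apply_sq_sunKineticLaw_le`'s `(√2)^D`. -/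
theorem integral_norm_apply_sq_sunKineticLaw_le_half_finrank (l : L) :
    ∫ p, ‖p l‖ ^ 2 ∂(sunMomentumLaw (L := L) μ (sunKinetic N)) ≤ (Module.finrank ℝ (SUNCoords N) : ℝ) / 2 := by
  rw [← integral_sunCoordQuad_apply_sunKineticLaw N μ l]
  exact integral_mono (integrable_norm_apply_sq_sunKineticLaw N μ l)
    (integrable_sunCoordQuad_apply_sunKineticLaw N μ l) fun p => norm_sq_le_sunCoordQuad N (p l)

/-- **`E‖p_l‖ ≤ √(D/2)`** (from `‖c‖ ≤ (‖c‖² + s²)/(2s)` with `s = √(D/2)`; for `D = 0` both sides vanish). -/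
theorem integral_norm_apply_sunKineticLaw_le_sqrt (l : L) :
    ∫ p, ‖p l‖ ∂(sunMomentumLaw (L := L) μ (sunKinetic N)) ≤ Real.sqrt ((Module.finrank ℝ (SUNCoords N) : ℝ) / 2) := by
  set ν := sunMomentumLaw (L := L) μ (sunKinetic N) with hν
  haveI : IsProbabilityMeasure ν := isProbabilityMeasure_sunMomentumLaw_sunKinetic N μ
  set s : ℝ := Real.sqrt ((Module.finrank ℝ (SUNCoords N) : ℝ) / 2) with hs
  have hs0 : 0 ≤ s := Real.sqrt_nonneg _
  have hss : s ^ 2 = (Module.finrank ℝ (SUNCoords N) : ℝ) / 2 := Real.sq_sqrt (by positivity)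
  have h2 := integral_norm_apply_sq_sunKineticLaw_le_half_finrank N μ l
  rcases hs0.eq_or_lt with hzero | hpos
  · -- `D = 0`: `E‖p_l‖² ≤ 0` forces `‖p_l‖ = 0` a.e.
    have hD0 : (Module.finrank ℝ (SUNCoords N) : ℝ) / 2 = 0 := by rw [← hss, ← hzero]; ring
    rw [hD0] at h2
    have hsq0 : ∫ p, ‖p l‖ ^ 2 ∂ν = 0 := le_antisymm h2 (integral_nonneg fun p => by positivity)
    have hae : (fun p : L → SUNCoords N => ‖p l‖ ^ 2) =ᵐ[ν] 0 :=
      (integral_eq_zero_iff_of_nonneg (fun p => by positivity) (integrable_norm_apply_sq_sunKineticLaw N μ l)).1 hsq0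
    have hae' : (fun p : L → SUNCoords N => ‖p l‖) =ᵐ[ν] fun _ => 0 := by
      filter_upwards [hae] with p hp
      have h0 : ‖p l‖ ^ 2 = 0 := hp
      exact (pow_eq_zero_iff (n := 2) (by norm_num)).1 h0
    have hint0 : ∫ p, ‖p l‖ ∂ν = 0 := by
      rw [integral_congr_ae hae', integral_const, smul_eq_mul, mul_zero]
    rw [hint0, ← hzero]
  · -- `‖c‖ ≤ (‖c‖² + s²)/(2s)`
    have h2s : 0 < 2 * s := by linarith
    have hpt : ∀ p : L → SUNCoords N, ‖p l‖ ≤ (‖p l‖ ^ 2 + s ^ 2) / (2 * s) := fun p => by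
      rw [le_div_iff₀ h2s]
      have hsq := sq_nonneg (‖p l‖ - s)
      have hex : (‖p l‖ - s) ^ 2 = ‖p l‖ ^ 2 + s ^ 2 - ‖p l‖ * (2 * s) := by ring
      linarith
    have hintR : Integrable (fun p : L → SUNCoords N => (‖p l‖ ^ 2 + s ^ 2) / (2 * s)) ν :=
      ((integrable_norm_apply_sq_sunKineticLaw N μ l).add (integrable_const _)).div_const _
    calc ∫ p, ‖p l‖ ∂ν ≤ ∫ p, (‖p l‖ ^ 2 + s ^ 2) / (2 * s) ∂ν :=
          integral_mono (integrable_norm_apply_sunKineticLaw N μ l) hintR hpt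
      _ = (∫ p, ‖p l‖ ^ 2 ∂ν + s ^ 2) / (2 * s) := by
          rw [integral_div, integral_add (integrable_norm_apply_sq_sunKineticLaw N μ l) (integrable_const _),
            integral_const, smul_eq_mul, probReal_univ, one_mul]
      _ ≤ (s ^ 2 + s ^ 2) / (2 * s) := by
          refine div_le_div_of_nonneg_right ?_ h2s.le
          rw [hss]; linarith
      _ = s := by field_simp; ring

/-- **`E Σ_l‖p_l‖ ≤ |L|·√(D/2)`.** -/
theorem integral_sum_norm_sunKineticLaw_le_sqrt :
    ∫ p, ∑ l, ‖p l‖ ∂(sunMomentumLaw (L := L) μ (sunKinetic N)) ≤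
      Fintype.card L * Real.sqrt ((Module.finrank ℝ (SUNCoords N) : ℝ) / 2) := by
  rw [integral_finsetSum _ fun l _ => integrable_norm_apply_sunKineticLaw N μ l]
  calc ∑ l, ∫ p, ‖p l‖ ∂(sunMomentumLaw (L := L) μ (sunKinetic N))
      ≤ ∑ _l : L, Real.sqrt ((Module.finrank ℝ (SUNCoords N) : ℝ) / 2) :=
        Finset.sum_le_sum fun l _ => integral_norm_apply_sunKineticLaw_le_sqrt N μ l
    _ = Fintype.card L * Real.sqrt ((Module.finrank ℝ (SUNCoords N) : ℝ) / 2) := by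
        rw [Finset.sum_const, Finset.card_univ, nsmul_eq_mul]

/-- **`E (Σ_l‖p_l‖)² ≤ |L|²·D/2`** (Cauchy–Schwarz `(Σ_l a_l)² ≤ |L|·Σ_l a_l²` and equipartition). -/
theorem integral_sq_sum_norm_sunKineticLaw_le_half_finrank :
    ∫ p, (∑ l, ‖p l‖) ^ 2 ∂(sunMomentumLaw (L := L) μ (sunKinetic N)) ≤
      (Fintype.card L : ℝ) ^ 2 * ((Module.finrank ℝ (SUNCoords N) : ℝ) / 2) := by
  have hcs : ∀ p : L → SUNCoords N, (∑ l, ‖p l‖) ^ 2 ≤ (Fintype.card L : ℝ) * ∑ l, ‖p l‖ ^ 2 := fun p => by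
    have h := sq_sum_le_card_mul_sum_sq (s := Finset.univ) (f := fun l => ‖p l‖)
    simpa only [Finset.card_univ] using h
  calc ∫ p, (∑ l, ‖p l‖) ^ 2 ∂(sunMomentumLaw (L := L) μ (sunKinetic N))
      ≤ ∫ p, (Fintype.card L : ℝ) * ∑ l, ‖p l‖ ^ 2 ∂(sunMomentumLaw (L := L) μ (sunKinetic N)) :=
        integral_mono (integrable_sq_sum_norm_sunKineticLaw N μ)
          ((integrable_finsetSum _ fun l _ => integrable_norm_apply_sq_sunKineticLaw N μ l).const_mul _) hcs
    _ = (Fintype.card L : ℝ) * ∑ l, ∫ p, ‖p l‖ ^ 2 ∂(sunMomentumLaw (L := L) μ (sunKinetic N)) := by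
        rw [integral_const_mul, integral_finsetSum _ fun l _ => integrable_norm_apply_sq_sunKineticLaw N μ l]
    _ ≤ (Fintype.card L : ℝ) * ∑ _l : L, (Module.finrank ℝ (SUNCoords N) : ℝ) / 2 := by
        gcongr with l
        exact integral_norm_apply_sq_sunKineticLaw_le_half_finrank N μ l
    _ = (Fintype.card L : ℝ) ^ 2 * ((Module.finrank ℝ (SUNCoords N) : ℝ) / 2) := by
        rw [Finset.sum_const, Finset.card_univ, nsmul_eq_mul]; ring
end Engine

/-! ## §3 The number of degrees of freedom: `D = finrank ℝ (SUNCoords N) = N² − 1` -/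

section Dimension

open Module

variable (N : ℕ)
/-- `2·#{(i,j) : i < j} + N = N²` (swap symmetry of the off-diagonal pairs plus the diagonal). -/
theorem two_mul_card_upperPair_add : 2 * Fintype.card (UpperPair N) + N = N * N := by
  classical
  set A : Finset (Fin N × Fin N) := Finset.univ.filter fun p => p.1 < p.2 with hA
  set B : Finset (Fin N × Fin N) := Finset.univ.filter fun p => p.2 < p.1 with hB
  set C : Finset (Fin N × Fin N) := Finset.univ.filter fun p => p.1 = p.2 with hC
  have hcardA : Fintype.card (UpperPair N) = A.card := by
    rw [hA, Fintype.card_subtype]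
  have hmem : ∀ (P : Fin N × Fin N → Prop) [DecidablePred P] (p : Fin N × Fin N),
      p ∈ Finset.univ.filter P ↔ P p := fun P _ p => by
    rw [Finset.mem_filter]; exact ⟨fun h => h.2, fun h => ⟨Finset.mem_univ _, h⟩⟩
  have hAB : B.card = A.card := by
    rw [hB, hA]
    refine Finset.card_bij (fun p _ => (p.2, p.1)) (fun p hp => ?_) (fun p hp q hq h => ?_) (fun q hq => ?_)
    · rw [hmem] at hp ⊢; exact hp
    · simp only [Prod.mk.injEq] at h; exact Prod.ext h.2 h.1
    · refine ⟨(q.2, q.1), ?_, rfl⟩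
      rw [hmem] at hq ⊢; exact hq
  have hCcard : C.card = N := by
    rw [hC]
    have : (Finset.univ.filter fun p : Fin N × Fin N => p.1 = p.2) = Finset.univ.image fun i : Fin N => (i, i) := by
      ext p
      rw [hmem, Finset.mem_image]
      constructor
      · intro h; exact ⟨p.1, Finset.mem_univ _, Prod.ext rfl h⟩
      · rintro ⟨i, -, rfl⟩; rfl
    rw [this, Finset.card_image_of_injective _ fun i j h => (Prod.mk.inj h).1, Finset.card_univ, Fintype.card_fin]
  have hdisj1 : Disjoint A B := by
    rw [hA, hB, Finset.disjoint_filter]; intro p _ h1 h2; exact lt_asymm h1 h2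
  have hdisj2 : Disjoint (A ∪ B) C := by
    rw [Finset.disjoint_left]; intro p hp hpC
    rw [Finset.mem_union, hA, hB, hmem, hmem] at hp
    rw [hC, hmem] at hpC
    rcases hp with h | h
    · exact absurd hpC (ne_of_lt h)
    · exact absurd hpC.symm (ne_of_lt h)
  have hunion : A ∪ B ∪ C = Finset.univ := by
    ext p
    rw [Finset.mem_union, Finset.mem_union, hA, hB, hC, hmem, hmem, hmem]
    simp only [Finset.mem_univ, iff_true]
    rcases lt_trichotomy p.1 p.2 with h | h | h
    · exact Or.inl (Or.inl h)
    · exact Or.inr h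
    · exact Or.inl (Or.inr h)
  have htot : (A ∪ B ∪ C).card = N * N := by
    rw [hunion, Finset.card_univ, Fintype.card_prod, Fintype.card_fin]
  rw [Finset.card_union_of_disjoint hdisj2, Finset.card_union_of_disjoint hdisj1, hAB, hCcard] at htot
  rw [hcardA]; omega

/-- `finrank ℝ (zeroSum N) + 1 = N` for `N ≥ 1` (rank–nullity for the surjective functional `Σ`). -/
theorem finrank_zeroSum_add_one (hN : 1 ≤ N) : finrank ℝ (zeroSum N) + 1 = N := by
  have hsurj : Function.Surjective (coordSum N) := by
    intro x
    refine ⟨Pi.single ⟨0, hN⟩ x, ?_⟩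
    simp [coordSum_apply]
  have hrange : finrank ℝ (LinearMap.range (coordSum N)) = 1 := by
    rw [LinearMap.range_eq_top.2 hsurj, finrank_top, Module.finrank_self]
  have h := LinearMap.finrank_range_add_finrank_ker (coordSum N)
  rw [hrange, Module.finrank_fintype_fun_eq_card, Fintype.card_fin] at h
  rw [zeroSum]; omega

/-- **`D + 1 = N²`**: `finrank ℝ (SUNCoords N) = N² − 1` for `N ≥ 1` — the number of real degrees of
freedom of one `𝔰𝔲(N)` momentum. -/
theorem finrank_sunCoords_add_one (hN : 1 ≤ N) : finrank ℝ (SUNCoords N) + 1 = N * N := by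
  have h1 := finrank_zeroSum_add_one N hN
  have h2 := two_mul_card_upperPair_add N
  rw [Module.finrank_prod, Module.finrank_prod, Module.finrank_fintype_fun_eq_card]
  omega

/-- The same as a real number: `(D : ℝ) = N² − 1`. -/
theorem finrank_sunCoords_eq (hN : 1 ≤ N) : (finrank ℝ (SUNCoords N) : ℝ) = (N : ℝ) ^ 2 - 1 := by
  have h := finrank_sunCoords_add_one N hN
  have h' : ((finrank ℝ (SUNCoords N) + 1 : ℕ) : ℝ) = ((N * N : ℕ) : ℝ) := by rw [h]
  push_cast at h'
  linarith

variable (μ : Measure (SUNCoords N)) [μ.IsAddHaarMeasure] {L : Type*} [Fintype L]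

/-- **`E q(p_l) = (N² − 1)/2`** per link under the engine's refresh law (`N ≥ 1`). -/
theorem integral_sunCoordQuad_apply_sunKineticLaw_eq (hN : 1 ≤ N) (l : L) :
    ∫ p, sunCoordQuad N (p l) ∂(sunMomentumLaw (L := L) μ (sunKinetic N)) = ((N : ℝ) ^ 2 - 1) / 2 := by
  rw [integral_sunCoordQuad_apply_sunKineticLaw, finrank_sunCoords_eq N hN]

/-- **`E(−Σ_l tr P_l²) = |L|·(N² − 1)/2`** — the engine's momentum heat-bath passes the equipartition
check exactly (`N ≥ 1`, any finite link set, any additive Haar reference measure). -/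
theorem integral_sunKinetic_sunKineticLaw_eq (hN : 1 ≤ N) :
    ∫ p, sunKinetic N p ∂(sunMomentumLaw (L := L) μ (sunKinetic N)) =
      Fintype.card L * (((N : ℝ) ^ 2 - 1) / 2) := by
  rw [integral_sunKinetic_sunKineticLaw, finrank_sunCoords_eq N hN]
end Dimension

end Summit.Ventures.LatticeQCDFlow.Exactness
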